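import Literature.AlgebraicGeometry.Motives.HodgeThetaSubalgebraUnitaryQuartic
import Literature.AlgebraicGeometry.Motives.HodgeThetaSubalgebraSymplecticRankTenSkew
import Literature.AlgebraicGeometry.Motives.HodgeLieRigid
import Literature.AlgebraicGeometry.Motives.HodgeStructureStrongCMGaloisPolarization
import HarnessLib

/-!
# A field of Hodge endomorphisms acting with BALANCED multiplicities and an embedding of multiplicity ONE is never central in `End_Hdg` (Shimura 1963, Thm. 5, the exceptional types IV with `r_ν = s_ν = 1`: `m = 2, d = 1` and `m = 1, d = 2` — «`End_ℚ(X)` contains a totally indefinite quaternion algebra over `K₀` with `F = K ⊂ F̃`»)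

Topic `Literature/AlgebraicGeometry/Motives` (abstract polarizable `ℚ`-Hodge structures; no geometry). Theorems only (no
definition, no named fact, nothing admitted; D-0026). Written for the cell `pub-hodge-ring2` (HONEST FRAMING of that cell:
research route conditional on HC_CM; not a corollary; Q11.4-sentence-2 already refuted in dim ≥ 3) — literature lane gen 75,
programme R52 «the two remaining rows IV(2,1) `⊇ k (2,2)` and IV `d = 2` of Moonen–Zarhin's fourfold table are EMPTY»; this
file is UNCONDITIONAL Hodge–Lie linear algebra.

THE PRINT. G. Shimura, *On analytic families of polarized abelian varieties and automorphic functions*, Ann. of Math. 78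
(1963), Thm. 5 (the five exceptional endomorphism structures), recalled with proofs by K. Hulek, R. Laface, Ann. Sc. Norm.
Super. Pisa 19 (2019) Prop. 5.1 [held `paper:arxiv-1703.05882` p0010 L19–L47]: «(4) `F` is of type IV, `m := g/d²e₀ = 2`,
`d = 1` and `r_ν = s_ν = 1` for all `ν`; (5) `F` is of type IV, `m = 1`, `d = 2` and `r_ν = s_ν = 1` for all `ν` … under the
assumption that our abelian variety `X` be simple, one can show that these cases never occur: … (4) `End_ℚ(X)` contains a
totally indefinite quaternion algebra `F̃` over `K₀` with `F = K ⊂ F̃`, so that `F = K ⊂ F̃ ⊂ End_ℚ(X) = F`, contradiction;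
(5) as in (1) and (2)» (Birkenhake–Lange, *Complex Abelian Varieties*, §9.9 Thm. 9.9.1 and Exercise 9.10 (4); B. B. Gordon,
*A survey of the Hodge conjecture for abelian varieties*, §1.13.4 [held `paper:arxiv-alg-geom_9709030` p0007 L116–p0008 L4]:
the list of endomorphism algebras of simple abelian fourfolds, read from Oort 1988 / Shimura 1963, contains neither a quartic
CM field with signature `{(1,1),(1,1)}` nor a quaternion algebra over an imaginary quadratic field).

WHAT IS PROVED (Hodge-theoretic core of cases (4)/(5), any rank). Let `H` be an effective polarized `ℚ`-Hodge structure of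
weight `1` on `V` with polarization `ψ`, `E` a number field acting by Hodge endomorphisms (`A : EndAction H E`, Deligne LNM 900
§4: `V_ℂ = ⊕_χ V_χ`, `E` acting on `V_χ` through `χ : E → ℂ`, multiplicities `n_χ = dim V_χ^{1,0}`), STABLE under the
Rosati involution of `ψ` (`(ι e)† ∈ ι(E)`).
* §1 `BalancedRankTwo.swap_comm` — the `𝔰𝔩₂`-accident `std ≅ std^∨` in coordinates: for a bilinear `B`, a `B`-skew `Y`
  and vectors `u', w'` with `Y u' = α u' + γ w'`, `Y w' = β u' - α w'` (trace ZERO on the plane), the rank-two operator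
  `S x = B(x, w') u' - B(x, u') w'` commutes with `Y`.
* §2 `EndAction.isInternal_eigenPiece_weightOne` (`V_ℂ = ⊕_{χ, (p,q)} V^{p,q}_χ` in weight one),
  `EndAction.trace_baseChange_mul_theta_eq_sum` (`tr((ι e)_ℂ ∘ Θ) = Σ_χ χ(e)(n_χ - n_χ̄)`); the general-weight
  decomposition is the tree's `EndAction.isInternal_eigenPiece_prod` (`Motives/HodgeStructureHalfTwistDeligneTorus`).
* (orthogonality `ψ_ℂ(V_χ₁, V_χ) = 0` unless `χ = χ̄₁` — the Rosati involution is complex conjugation through every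
  embedding — is the tree's `EndAction.form_baseChange_eq_zero_of_ne_conjugate`, `Motives/HodgeStructureStrongCMGaloisPolarization`.)
* §3 **`EndAction.trace_mul_eq_zero_of_mem_hodgeLie_of_balanced`** — if ALL multiplicities are balanced (`n_χ = n_χ̄`), then
  `tr(ι(e) ∘ X) = 0` for every `X ∈ Lie Hg(H)` and every `e ∈ E` («`Hg ⊆ SU_E`»: `Θ` is `E`-traceless, descent
  `mem_spanC_iInf_ker_of_forall_eq_zero`, and Deligne's rigidity `hodgeLie_rigid`); `EndAction.exists_lagrange_mem_span`
  (the projector onto `V_χ₀` is a complex polynomial in `(ι α)_ℂ`, `α` primitive).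
* §4 **`EndAction.exists_mem_endAlg_mul_ne_of_balanced_of_multiplicity_eq_one`** — MAIN: if moreover some embedding `χ₀`
  has `n_χ₀ = 1` (so `V_χ₀ = ℂu ⊕ ℂw` is a plane of Hodge type `(1,1)`), then for every `e₀ ∈ E` with `χ₀(e₀) ∉ ℝ` there is
  a Hodge endomorphism NOT commuting with `ι(e₀)`: `ι(E)` is not central in `End_Hdg(V)`. PROOF: by §4 every
  `Y ∈ (Lie Hg)_ℂ` is traceless on `V_χ̄₀ = ℂu' ⊕ ℂw'` (the trace is computed against the `ψ`-projector
  `x ↦ ψ(x,w')/ψ(u,w') u + ψ(x,u')/ψ(w,u') w`, which equals the Lagrange projector and is trace-orthogonal to `(Lie Hg)_ℂ`);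
  by §1 (and the `ψ_ℂ`-orthogonality of the eigenspaces) the swap `S : u ↦ ψ(u,w') u'` commutes with `(Lie Hg)_ℂ`, so lies
  in `End_Hdg(V) ⊗ ℂ` (Zarhin,
  `mem_span_endAlg_of_forall_commute`); but `S` moves the `χ₀(e₀)`-eigenvector `u` of `ι(e₀)` to the `conj χ₀(e₀)`-eigenvector
  `u'`, so `ι(e₀)` does not commute with `End_Hdg(V) ⊗ ℂ`, hence not with `End_Hdg(V)`. For `E = End⁰(X)` a quartic CM
  field on a fourfold (`m = 2`, `d = 1`, all `(r_ν, s_ν) = (1,1)`) this is the contradiction «`F = K ⊂ F̃ ⊂ End_ℚ(X) = F`»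
  of case (4); for `E = K(j) ⊂ D` a Rosati-stable maximal subfield of a quaternion algebra `D = End⁰(X)` over an imaginary
  quadratic `K` (`m = 1`, `d = 2`) with `e₀ ∈ K` central it is case (5). The geometric reading is
  `HodgeTheory/ShimuraExceptionalTypeIVFourfolds`.

## References

* [Shimura1963AnalyticFamilies] G. Shimura, Ann. of Math. 78 (1963) 149–192, Thm. 5 and §4 (exceptional cases (4), (5)).
* [HulekLaface2019PicardNumbersAV] K. Hulek, R. Laface, Ann. Sc. Norm. Super. Pisa (5) 19 (2019), Prop. 5.1, cases (4), (5)
  and proof (arXiv:1703.05882 p. 10).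
* [BirkenhakeLange2004] C. Birkenhake, H. Lange, *Complex Abelian Varieties*, §9.9 Thm. 9.9.1, Exercise 9.10 (4).
* [Gordon1997] B. B. Gordon, *A survey of the Hodge conjecture for abelian varieties*, §1.13.4 (endomorphism algebras of
  simple abelian fourfolds).
* [MoonenZarhin1995Duke] B. Moonen, Yu. Zarhin, Duke Math. J. 77 (1995), §2 (the function `σ ↦ n_σ`; the table of types).
* [Deligne1982HodgeCycles] P. Deligne, *Hodge cycles on abelian varieties*, LNM 900 (1982), I §3 Prop. 3.4, §4 (p. 30).
* [Zarhin1983HodgeGroupsK3] Yu. G. Zarhin, J. reine angew. Math. 341 (1983), §2 (the commutant of the Hodge group).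
-/

noncomputable section

open scoped TensorProduct
open Module

namespace Literature.AlgebraicGeometry.Motives

namespace HodgeStructure

universe u

/-! ### §1 The swap operator of a traceless skew plane -/

section Swap

variable {K : Type*} [Field K] {M : Type*} [AddCommGroup M] [Module K M]

/-- **The `𝔰𝔩₂`-accident `std ≅ std^∨`.** Let `B` be a bilinear form, `Y` a `B`-skew operator, and `u', w'` two vectors with
`Y u' = α u' + γ w'`, `Y w' = β u' - α w'` (so `Y` preserves the plane `⟨u', w'⟩` with trace zero there). Then the rank-two
operator `S x = B(x, w') u' - B(x, u') w'` commutes with `Y`. (For `B` a symplectic pairing between `⟨u, w⟩` and `⟨u', w'⟩`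
this is the intertwiner identifying the standard representation of `𝔰𝔩₂` with its dual; it is what makes Shimura's types
IV `(m, d) = (2, 1), (1, 2)` with all `r_ν = s_ν = 1` exceptional.) [cite: Shimura1963AnalyticFamilies, Thm. 5]
[cite: HulekLaface2019PicardNumbersAV, Prop. 5.1 (4), (5)] -/
theorem BalancedRankTwo.swap_comm (B : LinearMap.BilinForm K M) {Y : Module.End K M}
    (hY : ∀ x y, B (Y x) y + B x (Y y) = 0) {u' w' : M} {α β γ : K}
    (hu : Y u' = α • u' + γ • w') (hw : Y w' = β • u' - α • w') :
    ((LinearMap.flip B w').smulRight u' - (LinearMap.flip B u').smulRight w') * Y =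
      Y * ((LinearMap.flip B w').smulRight u' - (LinearMap.flip B u').smulRight w') := by
  refine LinearMap.ext fun x => ?_
  have h1 : B (Y x) w' = -B x (Y w') := eq_neg_of_add_eq_zero_left (hY x w')
  have h2 : B (Y x) u' = -B x (Y u') := eq_neg_of_add_eq_zero_left (hY x u')
  simp only [Module.End.mul_apply, LinearMap.sub_apply, LinearMap.smulRight_apply, LinearMap.flip_apply, map_sub,
    map_smul, hu, hw]
  rw [h1, h2, hu, hw, map_add, map_smul, map_smul, map_sub, map_smul, map_smul]
  simp only [smul_eq_mul]
  module

end Swap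

/-! ### §2 Traces over the decomposition `V_ℂ = ⊕_{χ,(p,q)} V^{p,q}_χ` -/

section Trace

variable {K : Type*} [Field K] {M : Type*} [AddCommGroup M] [Module K M] [FiniteDimensional K M]

/-- **The trace of an operator acting by the scalar `c i` on the summand `N i` of an internal direct sum is
`Σ_i c_i · dim N_i`.** [folklore] -/
private theorem trace_eq_sum_of_isInternal_of_forall_apply_eq_smul {ι : Type*} [Fintype ι] [DecidableEq ι]
    {N : ι → Submodule K M} (hN : DirectSum.IsInternal N) (f : Module.End K M) (c : ι → K) (hf : ∀ i, ∀ x ∈ N i, f x = c i • x) :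
    LinearMap.trace K M f = ∑ i, c i * (Module.finrank K (N i) : K) := by
  classical
  have hmaps : ∀ i, Set.MapsTo f (N i) (N i) := fun i x hx => by
    simp only [SetLike.mem_coe] at hx ⊢
    rw [hf i x hx]
    exact Submodule.smul_mem _ _ hx
  rw [LinearMap.trace_eq_sum_trace_restrict hN hmaps]
  refine Finset.sum_congr rfl fun i _ => ?_
  have hres : f.restrict (hmaps i) = c i • LinearMap.id := by
    refine LinearMap.ext fun x => Subtype.ext ?_
    rw [LinearMap.restrict_apply, LinearMap.smul_apply, LinearMap.id_apply, Submodule.coe_smul]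
    exact hf i x x.2
  rw [hres, map_smul, LinearMap.trace_id, smul_eq_mul]

end Trace

section Main

variable {V : Type u} [AddCommGroup V] [Module ℚ V] [Module.Finite ℚ V]
variable {E : Type*} [Field E] [NumberField E]

omit [NumberField E] in
/-- `σ̄̄ = σ` for complex embeddings. [folklore] -/
private theorem conjugate_conjugate_b (τ : E →+* ℂ) :
    NumberField.ComplexEmbedding.conjugate (NumberField.ComplexEmbedding.conjugate τ) = τ :=
  RingHom.ext fun x => by
    rw [NumberField.ComplexEmbedding.conjugate_coe_eq, NumberField.ComplexEmbedding.conjugate_coe_eq, Complex.conj_conj]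

omit [Module.Finite ℚ V] in
/-- `ι(e)` is a Hodge endomorphism (Deligne §4: `E` acts on `H¹_B` by endomorphisms of the Hodge structure).
[cite: Deligne1982HodgeCycles, §4 p. 30] -/
theorem EndAction.ι_mem_endAlg' {n : ℤ} {H : HodgeStructure V n} (A : EndAction H E) (e : E) : A.ι e ∈ H.endAlg :=
  A.map_F_le e

omit [Module.Finite ℚ V] in
/-- `dim V^{0,1}_χ = n_χ̄` (complex conjugation, `complexConj_eigenPiece_holds`). [cite: Deligne1982HodgeCycles, §4 p. 30] -/
theorem EndAction.finrank_eigenPiece_zero_one {H : HodgeStructure V 1} (A : EndAction H E) (χ : E →+* ℂ) :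
    Module.finrank ℂ ↥(A.eigenPiece χ 0 1) = A.multiplicity (NumberField.ComplexEmbedding.conjugate χ) := by
  have h := EndAction.complexConj_eigenPiece_holds A (NumberField.ComplexEmbedding.conjugate χ) 1 0
  rw [conjugate_conjugate_b] at h
  rw [EndAction.multiplicity, ← h, finrank_complexConj]

omit [Module.Finite ℚ V] in
open scoped Classical in
/-- **`V_ℂ = ⊕_{χ, (p,q)} V^{p,q}_χ` is an internal direct sum** for an effective weight-one Hodge structure with an action of
a number field `E` (index `(χ, true) ↦ V^{1,0}_χ`, `(χ, false) ↦ V^{0,1}_χ`; Deligne §4: `H¹_B ⊗ ℂ = ⊕_σ H¹_{B,σ}`,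
`H¹_{B,σ} = H^{1,0}_σ ⊕ H^{0,1}_σ`). [cite: Deligne1982HodgeCycles, §4 p. 30] [cite: MoonenZarhin1995Duke, §2] -/
theorem EndAction.isInternal_eigenPiece_weightOne [HodgeTensorFacts.{u, u}] {H : HodgeStructure V 1} (heff : H.IsEffective)
    (A : EndAction H E) :
    DirectSum.IsInternal fun i : (E →+* ℂ) × Bool => cond i.2 (A.eigenPiece i.1 1 0) (A.eigenPiece i.1 0 1) := by
  classical
  obtain ⟨Θ, hΘ⟩ := exists_hodgeTheta H
  obtain ⟨hP, hQ, hΘ10, hΘ01, -⟩ := UnitaryTheta.theta_facts H rfl heff hΘ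
  set N : (E →+* ℂ) × Bool → Submodule ℂ (ℂ ⊗[ℚ] V) := fun i => cond i.2 (A.eigenPiece i.1 1 0) (A.eigenPiece i.1 0 1)
    with hN
  -- the two Hodge pieces are disjoint
  have hdisj : H.piece 1 0 ⊓ H.piece 0 1 = ⊥ := by
    rw [eq_bot_iff]
    intro x hx
    rw [Submodule.mem_bot]
    have h1 := hΘ10 x hx.1
    have h2 := hΘ01 x hx.2
    rw [h1] at h2
    have h3 : (2 : ℂ) • x = 0 := by rw [two_smul]; nth_rewrite 2 [h2]; rw [add_neg_cancel]
    exact (smul_eq_zero.1 h3).resolve_left two_ne_zero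
  refine DirectSum.isInternal_submodule_of_iSupIndep_of_iSup_eq_top ?_ ?_
  · -- independence
    intro i
    rcases i with ⟨χ, b⟩
    -- the other summands lie in `(⊕_{χ' ≠ χ} same type) ⊔ (other type)`
    cases b with
    | true =>
      have hle : (⨆ j ≠ ((χ, true) : (E →+* ℂ) × Bool), N j) ≤
          (⨆ χ' ≠ χ, A.eigenPiece χ' 1 0) ⊔ H.piece 0 1 := by
        refine iSup₂_le fun j hj => ?_
        rcases j with ⟨χ', b'⟩
        cases b' with
        | true =>
          have hχ' : χ' ≠ χ := fun h => hj (by rw [h])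
          exact le_sup_of_le_left (le_iSup₂_of_le (f := fun χ' (_ : χ' ≠ χ) => A.eigenPiece χ' 1 0) χ' hχ' le_rfl)
        | false => exact le_sup_of_le_right (A.eigenPiece_le_piece χ' 0 1)
      rw [disjoint_iff, eq_bot_iff]
      rintro x ⟨hx1, hx2⟩
      have hx1' : x ∈ A.eigenPiece χ 1 0 := hx1
      obtain ⟨a, ha, b, hb, rfl⟩ := Submodule.mem_sup.1 (hle hx2)
      have ha10 : a ∈ H.piece 1 0 := by
        refine (iSup₂_le fun χ' _ => A.eigenPiece_le_piece χ' 1 0 : (⨆ χ' ≠ χ, A.eigenPiece χ' 1 0) ≤ H.piece 1 0) ha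
      have hb0 : b = 0 := by
        have hb10 : b ∈ H.piece 1 0 := by
          have h := Submodule.sub_mem _ (A.eigenPiece_le_piece χ 1 0 hx1') ha10
          rwa [add_sub_cancel_left] at h
        have h : b ∈ H.piece 1 0 ⊓ H.piece 0 1 := ⟨hb10, hb⟩
        rwa [hdisj, Submodule.mem_bot] at h
      rw [hb0, add_zero] at hx1' ⊢
      have hind := (EndAction.iSupIndep_eigenPiece_holds A 1 0) χ
      rw [disjoint_iff, eq_bot_iff] at hind
      exact hind ⟨hx1', ha⟩
    | false =>
      have hle : (⨆ j ≠ ((χ, false) : (E →+* ℂ) × Bool), N j) ≤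
          (⨆ χ' ≠ χ, A.eigenPiece χ' 0 1) ⊔ H.piece 1 0 := by
        refine iSup₂_le fun j hj => ?_
        rcases j with ⟨χ', b'⟩
        cases b' with
        | false =>
          have hχ' : χ' ≠ χ := fun h => hj (by rw [h])
          exact le_sup_of_le_left (le_iSup₂_of_le (f := fun χ' (_ : χ' ≠ χ) => A.eigenPiece χ' 0 1) χ' hχ' le_rfl)
        | true => exact le_sup_of_le_right (A.eigenPiece_le_piece χ' 1 0)
      rw [disjoint_iff, eq_bot_iff]
      rintro x ⟨hx1, hx2⟩
      have hx1' : x ∈ A.eigenPiece χ 0 1 := hx1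
      obtain ⟨a, ha, b, hb, rfl⟩ := Submodule.mem_sup.1 (hle hx2)
      have ha01 : a ∈ H.piece 0 1 := by
        refine (iSup₂_le fun χ' _ => A.eigenPiece_le_piece χ' 0 1 : (⨆ χ' ≠ χ, A.eigenPiece χ' 0 1) ≤ H.piece 0 1) ha
      have hb0 : b = 0 := by
        have hb01 : b ∈ H.piece 0 1 := by
          have h := Submodule.sub_mem _ (A.eigenPiece_le_piece χ 0 1 hx1') ha01
          rwa [add_sub_cancel_left] at h
        have h : b ∈ H.piece 1 0 ⊓ H.piece 0 1 := ⟨hb, hb01⟩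
        rwa [hdisj, Submodule.mem_bot] at h
      rw [hb0, add_zero] at hx1' ⊢
      have hind := (EndAction.iSupIndep_eigenPiece_holds A 0 1) χ
      rw [disjoint_iff, eq_bot_iff] at hind
      exact hind ⟨hx1', ha⟩
  · -- spanning
    rw [Submodule.eq_top_iff']
    intro x
    have hdec : x = (2 : ℂ)⁻¹ • (x + Θ x) + (2 : ℂ)⁻¹ • (x - Θ x) := by module
    have h10 : H.piece 1 0 ≤ ⨆ i, N i := by
      rw [← EndAction.iSup_eigenPiece_holds A 1 0]
      exact iSup_le fun χ => le_iSup_of_le (f := N) (χ, true) le_rfl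
    have h01 : H.piece 0 1 ≤ ⨆ i, N i := by
      rw [← EndAction.iSup_eigenPiece_holds A 0 1]
      exact iSup_le fun χ => le_iSup_of_le (f := N) (χ, false) le_rfl
    rw [hdec]
    exact Submodule.add_mem _ (h10 (hP x)) (h01 (hQ x))

/-- **`tr((ι e)_ℂ ∘ Θ) = Σ_χ χ(e) · (n_χ - n_χ̄)`** for the Hodge grading operator `Θ` (`= +1` on `V^{1,0}`, `-1` on `V^{0,1}`)
of an effective weight-one Hodge structure with an `E`-action: on `V^{1,0}_χ` the operator is `χ(e)`, on `V^{0,1}_χ` it is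
`-χ(e)`, and `dim V^{0,1}_χ = n_χ̄` (Moonen–Zarhin's multiplicities; the Lie form of «`det_E ∘ h`»).
[cite: MoonenZarhin1995Duke, §2] [cite: Deligne1982HodgeCycles, §4 p. 30] -/
theorem EndAction.trace_baseChange_mul_theta_eq_sum [HodgeTensorFacts.{u, u}] {H : HodgeStructure V 1}
    (heff : H.IsEffective) (A : EndAction H E) {Θ : Module.End ℂ (ℂ ⊗[ℚ] V)}
    (hΘ : ∀ p, ∀ x ∈ H.piece p (1 - p), Θ x = ((2 * p - 1 : ℤ) : ℂ) • x) (e : E) :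
    LinearMap.trace ℂ _ ((A.ι e).baseChange ℂ * Θ) =
      ∑ χ : E →+* ℂ, χ e * ((A.multiplicity χ : ℂ) - A.multiplicity (NumberField.ComplexEmbedding.conjugate χ)) := by
  classical
  obtain ⟨-, -, hΘ10, hΘ01, -⟩ := UnitaryTheta.theta_facts H rfl heff hΘ
  have hint := EndAction.isInternal_eigenPiece_weightOne heff A
  rw [trace_eq_sum_of_isInternal_of_forall_apply_eq_smul hint ((A.ι e).baseChange ℂ * Θ)
    (fun i : (E →+* ℂ) × Bool => cond i.2 (i.1 e) (-(i.1 e))) ?_]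
  · rw [Fintype.sum_prod_type]
    refine Finset.sum_congr rfl fun χ _ => ?_
    rw [Fintype.sum_bool]
    have h01 := EndAction.finrank_eigenPiece_zero_one A χ
    have h10 : Module.finrank ℂ ↥(A.eigenPiece χ 1 0) = A.multiplicity χ := rfl
    simp only [cond_true, cond_false]
    erw [h01, h10]
    ring
  · rintro ⟨χ, b⟩ x hx
    cases b with
    | true =>
      simp only [cond_true] at hx ⊢
      rw [EndAction.mem_eigenPiece_iff] at hx
      rw [Module.End.mul_apply, hΘ10 x hx.1, hx.2 e]
    | false =>
      simp only [cond_false] at hx ⊢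
      rw [EndAction.mem_eigenPiece_iff] at hx
      rw [Module.End.mul_apply, hΘ01 x hx.1, map_neg, hx.2 e, neg_smul]

/-! ### §3 Balanced multiplicities: `Lie Hg(H)` is `E`-traceless («`Hg ⊆ SU_E`») -/

variable [HodgeTensorFacts.{u, u}]

/-- **Balanced multiplicities force `tr(ι(e) ∘ X) = 0` for every `X ∈ Lie Hg(H)` and `e ∈ E`** («`Hg(X) ⊆ SU_E(V, ψ)`»
infinitesimally; Moonen–Zarhin: `Hg` is semisimple iff `n_σ = n_σ̄`). PROOF: the rational subspace
`T = {X : tr(ι(e) X) = 0 ∀ e}` has complexification `{Y : tr((ι e)_ℂ Y) = 0 ∀ e}` (descent,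
`mem_spanC_iInf_ker_of_forall_eq_zero`), which contains `Θ` by `trace_baseChange_mul_theta_eq_sum` and the balance;
`Lie Hg ∩ T` is bracket-closed (`ι(e)` commutes with `Lie Hg`, cyclicity of the trace), so Deligne's rigidity
(`hodgeLie_rigid`) gives `Lie Hg ⊆ T`. [cite: Deligne1982HodgeCycles, I §3 Prop. 3.4] [cite: MoonenZarhin1995Duke, §2]
[cite: Shimura1963AnalyticFamilies, Thm. 5] -/
theorem EndAction.trace_mul_eq_zero_of_mem_hodgeLie_of_balanced {H : HodgeStructure V 1} (heff : H.IsEffective)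
    (ψ : H.Polarization) (A : EndAction H E)
    (hbal : ∀ χ : E →+* ℂ, A.multiplicity χ = A.multiplicity (NumberField.ComplexEmbedding.conjugate χ))
    {X : Module.End ℚ V} (hX : X ∈ H.hodgeLie) (e : E) : LinearMap.trace ℚ V (A.ι e * X) = 0 := by
  classical
  obtain ⟨Θ, hΘ⟩ := exists_hodgeTheta H
  -- the rational trace conditions and their complexifications
  set p : E → (Module.End ℚ V →ₗ[ℚ] ℚ) := fun e => LinearMap.trace ℚ V ∘ₗ LinearMap.mulLeft ℚ (A.ι e) with hp
  set P : E → (Module.End ℂ (ℂ ⊗[ℚ] V) →ₗ[ℂ] ℂ) :=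
    fun e => LinearMap.trace ℂ (ℂ ⊗[ℚ] V) ∘ₗ LinearMap.mulLeft ℂ ((A.ι e).baseChange ℂ) with hP
  have hpapp : ∀ e X, p e X = LinearMap.trace ℚ V (A.ι e * X) := fun e X => rfl
  have hPapp : ∀ e Y, P e Y = LinearMap.trace ℂ _ ((A.ι e).baseChange ℂ * Y) := fun e Y => rfl
  have hpP : ∀ e (X : Module.End ℚ V), P e (X.baseChange ℂ) = algebraMap ℚ ℂ (p e X) := by
    intro e X
    rw [hPapp, hpapp, ← LinearMap.baseChange_mul, LinearMap.trace_baseChange]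
  set T : Submodule ℚ (Module.End ℚ V) := ⨅ e, LinearMap.ker (p e) with hT
  -- `Θ ∈ T_ℂ`
  have hΘT : Θ ∈ spanC T := by
    refine mem_spanC_iInf_ker_of_forall_eq_zero p P hpP fun e => ?_
    rw [hPapp, EndAction.trace_baseChange_mul_theta_eq_sum heff A hΘ e]
    refine Finset.sum_eq_zero fun χ _ => ?_
    rw [hbal χ, sub_self, mul_zero]
  -- `𝔞 = Lie Hg ∩ T` is bracket-closed and `Θ ∈ 𝔞_ℂ`
  set 𝔞 : Submodule ℚ (Module.End ℚ V) := H.hodgeLie ⊓ T with h𝔞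
  have hbr : ∀ X ∈ 𝔞, ∀ Y ∈ 𝔞, X * Y - Y * X ∈ 𝔞 := by
    intro X hX Y hY
    refine ⟨H.commutator_mem_hodgeLie hX.1 hY.1, Submodule.mem_iInf _ |>.2 fun e => ?_⟩
    rw [LinearMap.mem_ker, hpapp, mul_sub, map_sub]
    have hcX : A.ι e * X = X * A.ι e := (H.commute_of_mem_hodgeLie hX.1 ⟨A.ι e, A.ι_mem_endAlg' e⟩).symm
    have h1 : LinearMap.trace ℚ V (A.ι e * (Y * X)) = LinearMap.trace ℚ V (A.ι e * (X * Y)) := by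
      rw [← mul_assoc, LinearMap.trace_mul_comm, ← mul_assoc, ← hcX, mul_assoc]
    rw [h1, sub_self]
  have hΘ𝔞 : Θ ∈ spanC 𝔞 := by
    rw [h𝔞, spanC_inf_eq]
    exact ⟨(hodgeLieC_eq_spanC H) ▸ H.mem_hodgeLieC_of_forall_piece hΘ, hΘT⟩
  -- rigidity
  have hle : H.hodgeLie ≤ 𝔞 := hodgeLie_rigid H ⟨ψ⟩ 𝔞 inf_le_left hbr ⟨Θ, hΘ𝔞, hΘ⟩
  have hXT : X ∈ T := (hle hX).2
  have hXe := (Submodule.mem_iInf _ |>.1 hXT) e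
  rwa [LinearMap.mem_ker, hpapp] at hXe

/-- Complex form: `tr((ι e)_ℂ ∘ Y) = 0` for every `Y ∈ (Lie Hg)_ℂ`. [cite: Deligne1982HodgeCycles, I §3 Prop. 3.4] -/
theorem EndAction.trace_baseChange_mul_eq_zero_of_mem_hodgeLieC_of_balanced {H : HodgeStructure V 1}
    (heff : H.IsEffective) (ψ : H.Polarization) (A : EndAction H E)
    (hbal : ∀ χ : E →+* ℂ, A.multiplicity χ = A.multiplicity (NumberField.ComplexEmbedding.conjugate χ))
    {Y : Module.End ℂ (ℂ ⊗[ℚ] V)} (hY : Y ∈ H.hodgeLieC) (e : E) :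
    LinearMap.trace ℂ _ ((A.ι e).baseChange ℂ * Y) = 0 := by
  induction hY using Submodule.span_induction with
  | mem Z hZ =>
    obtain ⟨X, hX, rfl⟩ := hZ
    rw [← LinearMap.baseChange_mul, LinearMap.trace_baseChange,
      EndAction.trace_mul_eq_zero_of_mem_hodgeLie_of_balanced heff ψ A hbal hX e, map_zero]
  | zero => rw [mul_zero, map_zero]
  | add Z Z' _ _ hZ hZ' => rw [mul_add, map_add, hZ, hZ', add_zero]
  | smul c Z _ hZ => rw [mul_smul_comm, map_smul, hZ, smul_zero]

omit [Module.Finite ℚ V] [HodgeTensorFacts.{u, u}] in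
open scoped Classical in
/-- **The projector onto one eigenspace `V_{χ₀}` is a complex polynomial in `(ι α)_ℂ`** (`α` a primitive element of `E`,
Lagrange interpolation at the pairwise distinct `χ(α)`; Deligne §4: `E ⊗ ℂ = ∏_σ ℂ`): there is `Z` in the `ℂ`-span of the
`(ι e)_ℂ` acting on `V_χ = ⋂_e ker((ι e)_ℂ - χ e)` as `1` if `χ = χ₀` and as `0` otherwise.
[cite: Deligne1982HodgeCycles, §4 p. 30] -/
theorem EndAction.exists_lagrange_mem_span {n : ℤ} {H : HodgeStructure V n} (A : EndAction H E) (χ₀ : E →+* ℂ) :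
    ∃ Z ∈ Submodule.span ℂ (Set.range fun e : E => (A.ι e).baseChange ℂ),
      ∀ (χ : E →+* ℂ) (x : ℂ ⊗[ℚ] V), (∀ e, (A.ι e).baseChange ℂ x = χ e • x) →
        Z x = (if χ = χ₀ then (1 : ℂ) else 0) • x := by
  classical
  obtain ⟨α, hα⟩ := Field.exists_primitive_element ℚ E
  have hinj : Function.Injective fun σ : E →+* ℂ => σ α := EndAction.complexEmbedding_apply_injective_of_adjoin_eq_top hα
  set v : (E →+* ℂ) → ℂ := fun σ => σ α with hv
  set L : Polynomial ℂ := Lagrange.basis Finset.univ v χ₀ with hL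
  refine ⟨Polynomial.aeval ((A.ι α).baseChange ℂ) L, ?_, ?_⟩
  · rw [Polynomial.aeval_eq_sum_range]
    refine Submodule.sum_mem _ fun k _ => Submodule.smul_mem _ _ ?_
    have hk : ((A.ι α).baseChange ℂ) ^ k = (fun e : E => (A.ι e).baseChange ℂ) (α ^ k) := by
      simp only [map_pow, LinearMap.baseChange_pow]
    rw [hk]
    exact Submodule.subset_span (Set.mem_range_self _)
  · intro χ x hx
    by_cases hx0 : x = 0
    · rw [hx0, map_zero, smul_zero]
    have hev : Module.End.HasEigenvector ((A.ι α).baseChange ℂ) (χ α) x :=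
      ⟨Module.End.mem_eigenspace_iff.2 (hx α), hx0⟩
    rw [Module.End.aeval_apply_of_hasEigenvector hev]
    congr 1
    by_cases hχ : χ = χ₀
    · subst hχ
      rw [if_pos rfl, hL]
      exact Lagrange.eval_basis_self (hinj.injOn.mono (Set.subset_univ _)) (Finset.mem_univ _)
    · rw [if_neg hχ, hL]
      exact Lagrange.eval_basis_of_ne (v := v) (Ne.symm hχ) (Finset.mem_univ _)

/-! ### §4 The main theorem: a balanced field with an embedding of multiplicity one is not central in `End_Hdg` -/

/-- **MAIN THEOREM (Shimura's exceptional types IV with `r_ν = s_ν = 1`, Hodge-theoretic core).** Let `H` be an effective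
polarized `ℚ`-Hodge structure of weight `1`, `E` a number field acting on `H` by Hodge endomorphisms, stable under the Rosati
involution of the polarization `ψ` (`(ι e)† ∈ ι(E)`), with BALANCED multiplicities `n_χ = n_χ̄` for all `χ : E → ℂ`, and suppose
ONE embedding has `n_{χ₀} = 1`. Then for every `e₀ ∈ E` with `χ₀(e₀) ∉ ℝ` some Hodge endomorphism of `H` does NOT commute with
`ι(e₀)` — `ι(E)` is not contained in the centre of `End_Hdg(V)`. For `E = End⁰(X)` a CM field with `dim_E H¹ = 2` and all
signatures `(1,1)` this is Shimura's case (4) («`End_ℚ(X) ⊋ F`»), for `E ⊂ End⁰(X)` a Rosati-stable maximal subfield of a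
quaternion algebra over an imaginary quadratic centre `K ∋ e₀` it is case (5).
[cite: Shimura1963AnalyticFamilies, Thm. 5] [cite: HulekLaface2019PicardNumbersAV, Prop. 5.1 (4), (5) and proof]
[cite: BirkenhakeLange2004, §9.9 Thm. 9.9.1 and Exercise 9.10 (4)] [cite: Zarhin1983HodgeGroupsK3, §2] -/
theorem EndAction.exists_mem_endAlg_mul_ne_of_balanced_of_multiplicity_eq_one {H : HodgeStructure V 1}
    (heff : H.IsEffective) (ψ : H.Polarization) (A : EndAction H E)
    (hros : ∀ e : E, ψ.adjoint (A.ι e) ∈ Set.range A.ι)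
    (hbal : ∀ χ : E →+* ℂ, A.multiplicity χ = A.multiplicity (NumberField.ComplexEmbedding.conjugate χ))
    {χ₀ : E →+* ℂ} (hone : A.multiplicity χ₀ = 1) {e₀ : E} (he₀ : starRingEnd ℂ (χ₀ e₀) ≠ χ₀ e₀) :
    ∃ a ∈ H.endAlg, a * A.ι e₀ ≠ A.ι e₀ * a := by
  classical
  -- `V ≠ 0`
  haveI : Nontrivial V := by
    have h1 := Submodule.finrank_le (A.eigenPiece χ₀ 1 0)
    have h2 : Module.finrank ℂ ↥(A.eigenPiece χ₀ 1 0) = 1 := hone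
    rw [Module.finrank_baseChange, h2] at h1
    exact (Module.finrank_pos_iff (R := ℚ)).1 h1
  set χ₁ := NumberField.ComplexEmbedding.conjugate χ₀ with hχ₁
  have hχ₁₀ : NumberField.ComplexEmbedding.conjugate χ₁ = χ₀ := conjugate_conjugate_b χ₀
  set B := ψ.form.baseChange ℂ with hB
  set ιC : E → Module.End ℂ (ℂ ⊗[ℚ] V) := fun e => (A.ι e).baseChange ℂ with hιC
  obtain ⟨Θ, hΘ⟩ := exists_hodgeTheta H
  obtain ⟨hP, hQ, hΘ10, hΘ01, -⟩ := UnitaryTheta.theta_facts H rfl heff hΘ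
  have hΘC : Θ ∈ H.hodgeLieC := H.mem_hodgeLieC_of_forall_piece hΘ
  have hΘι : ∀ e, Θ * ιC e = ιC e * Θ := fun e =>
    commute_baseChange_of_mem_hodgeLieC H hΘC ⟨A.ι e, A.ι_mem_endAlg' e⟩
  -- skew-symmetry of `B` (weight one) and skewness of `(Lie Hg)_ℂ`
  have hBswap : ∀ x y, B y x = -B x y := form_baseChange_swap_of_odd H odd_one ψ
  have hskewC : ∀ Y ∈ H.hodgeLieC, ∀ x y, B (Y x) y + B x (Y y) = 0 := fun Y hY x y => by
    rw [hB, formBaseChange_skew_of_mem_hodgeLieC ψ hY, neg_add_cancel]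
  -- dimensions `1` of the four lines
  have h10 : Module.finrank ℂ ↥(A.eigenPiece χ₀ 1 0) = 1 := hone
  have h10' : Module.finrank ℂ ↥(A.eigenPiece χ₁ 1 0) = 1 := by
    change A.multiplicity χ₁ = 1
    rw [hχ₁, ← hbal χ₀]; exact hone
  have h01 : Module.finrank ℂ ↥(A.eigenPiece χ₀ 0 1) = 1 := by
    rw [EndAction.finrank_eigenPiece_zero_one, ← hbal χ₀]; exact hone
  have h01' : Module.finrank ℂ ↥(A.eigenPiece χ₁ 0 1) = 1 := by
    rw [EndAction.finrank_eigenPiece_zero_one, hχ₁₀]; exact hone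
  -- generators
  have hgen : ∀ (W : Submodule ℂ (ℂ ⊗[ℚ] V)), Module.finrank ℂ W = 1 →
      ∃ v ∈ W, v ≠ 0 ∧ ∀ y ∈ W, ∃ c : ℂ, y = c • v := by
    intro W hW
    have hW0 : W ≠ ⊥ := fun h => by rw [h, finrank_bot] at hW; exact zero_ne_one hW
    obtain ⟨v, hvW, hv0⟩ := Submodule.exists_mem_ne_zero_of_ne_bot hW0
    refine ⟨v, hvW, hv0, fun y hy => ?_⟩
    have hv0' : (⟨v, hvW⟩ : W) ≠ 0 := fun h => hv0 (congrArg Subtype.val h)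
    obtain ⟨c, hc⟩ := (finrank_eq_one_iff_of_nonzero' (⟨v, hvW⟩ : W) hv0').1 hW ⟨y, hy⟩
    refine ⟨c, ?_⟩
    have hc' := congrArg Subtype.val hc
    simp only [SetLike.mk_smul_mk] at hc'
    exact hc'.symm
  obtain ⟨u, hu, hu0, hu_gen⟩ := hgen _ h10
  obtain ⟨w, hw, hw0, hw_gen⟩ := hgen _ h01
  obtain ⟨u', hu', hu'0, hu'_gen⟩ := hgen _ h10'
  obtain ⟨w', hw', hw'0, hw'_gen⟩ := hgen _ h01'
  have hu_mem := (EndAction.mem_eigenPiece_iff A χ₀ 1 0 u).1 hu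
  have hw_mem := (EndAction.mem_eigenPiece_iff A χ₀ 0 1 w).1 hw
  have hu'_mem := (EndAction.mem_eigenPiece_iff A χ₁ 1 0 u').1 hu'
  have hw'_mem := (EndAction.mem_eigenPiece_iff A χ₁ 0 1 w').1 hw'
  -- type orthogonality
  have hB1010 : ∀ x ∈ H.piece 1 0, ∀ y ∈ H.piece 1 0, B x y = 0 := fun x hx y hy =>
    ψ.form_piece_piece (p := 1) (p' := 1) (by norm_num) (by simpa using hx) (by simpa using hy)
  have hB0101 : ∀ x ∈ H.piece 0 1, ∀ y ∈ H.piece 0 1, B x y = 0 := fun x hx y hy =>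
    ψ.form_piece_piece (p := 0) (p' := 0) (by norm_num) (by simpa using hx) (by simpa using hy)
  -- eigenspace orthogonality (the Rosati involution is complex conjugation through every embedding; the tree's
  -- `EndAction.form_baseChange_eq_zero_of_ne_conjugate`): `B(V_{χ₀}, V_χ) = 0` for `χ ≠ χ₁`, `B(V_{χ₁}, V_χ) = 0` for `χ ≠ χ₀`
  have horth : ∀ (χ' χ : E →+* ℂ), χ' ≠ NumberField.ComplexEmbedding.conjugate χ → ∀ x y,
      (∀ e, ιC e x = χ' e • x) → (∀ e, ιC e y = χ e • y) → B x y = 0 := fun χ' χ hne x y hx hy =>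
    A.form_baseChange_eq_zero_of_ne_conjugate ψ hros hne ((EndAction.mem_iInf_eigenspace_iff A χ' x).2 hx)
      ((EndAction.mem_iInf_eigenspace_iff A χ y).2 hy)
  have horth₀ : ∀ (χ : E →+* ℂ), χ ≠ χ₁ → ∀ x y, (∀ e, ιC e x = χ₀ e • x) → (∀ e, ιC e y = χ e • y) → B x y = 0 :=
    fun χ hχ x y hx hy => horth χ₀ χ (fun h => hχ (by rw [hχ₁, h, conjugate_conjugate_b])) x y hx hy
  have horth₁ : ∀ (χ : E →+* ℂ), χ ≠ χ₀ → ∀ x y, (∀ e, ιC e x = χ₁ e • x) → (∀ e, ιC e y = χ e • y) → B x y = 0 :=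
    fun χ hχ x y hx hy => horth χ₁ χ (fun h => hχ (by rw [← hχ₁₀, h, conjugate_conjugate_b])) x y hx hy
  -- the decomposition of `V_{χ₁}` and `V_{χ₀}` along the two lines
  have hdec : ∀ (χ : E →+* ℂ) (a b : ℂ ⊗[ℚ] V), (∀ y ∈ A.eigenPiece χ 1 0, ∃ c : ℂ, y = c • a) →
      (∀ y ∈ A.eigenPiece χ 0 1, ∃ c : ℂ, y = c • b) →
      ∀ y, (∀ e, ιC e y = χ e • y) → ∃ c d : ℂ, y = c • a + d • b := by
    intro χ a b ha hb y hy
    have hΘy : ∀ e, ιC e (Θ y) = χ e • Θ y := fun e => by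
      rw [← Module.End.mul_apply, ← hΘι e, Module.End.mul_apply, hy e, map_smul]
    have hPy : (2 : ℂ)⁻¹ • (y + Θ y) ∈ A.eigenPiece χ 1 0 := by
      rw [EndAction.mem_eigenPiece_iff]
      refine ⟨hP y, fun e => ?_⟩
      rw [map_smul, map_add, hy e, hΘy e, ← smul_add, smul_comm]
    have hQy : (2 : ℂ)⁻¹ • (y - Θ y) ∈ A.eigenPiece χ 0 1 := by
      rw [EndAction.mem_eigenPiece_iff]
      refine ⟨hQ y, fun e => ?_⟩
      rw [map_smul, map_sub, hy e, hΘy e, ← smul_sub, smul_comm]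
    obtain ⟨c, hc⟩ := ha _ hPy
    obtain ⟨d, hd⟩ := hb _ hQy
    refine ⟨c, d, ?_⟩
    have hy' : y = (2 : ℂ)⁻¹ • (y + Θ y) + (2 : ℂ)⁻¹ • (y - Θ y) := by module
    rw [← hc, ← hd]
    exact hy'
  have hdec₁ := hdec χ₁ u' w' hu'_gen hw'_gen
  have hdec₀ := hdec χ₀ u w hu_gen hw_gen
  -- the key pairings
  have hBuu' : B u u' = 0 := hB1010 u hu_mem.1 u' hu'_mem.1
  have hBww' : B w w' = 0 := hB0101 w hw_mem.1 w' hw'_mem.1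
  -- `V_ℂ` is spanned by the eigen-pieces
  have hint := EndAction.isInternal_eigenPiece_weightOne heff A
  have htop : (⨆ i : (E →+* ℂ) × Bool, cond i.2 (A.eigenPiece i.1 1 0) (A.eigenPiece i.1 0 1)) = ⊤ := hint.submodule_iSup_eq_top
  -- non-degeneracy: `B u w' ≠ 0` and `B w u' ≠ 0`
  have hmemχ : ∀ (i : (E →+* ℂ) × Bool) (y : ℂ ⊗[ℚ] V), y ∈ cond i.2 (A.eigenPiece i.1 1 0) (A.eigenPiece i.1 0 1) →
      (∀ e, ιC e y = i.1 e • y) ∧ (i.2 = true → y ∈ H.piece 1 0) ∧ (i.2 = false → y ∈ H.piece 0 1) := by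
    rintro ⟨χ, b⟩ y hy
    cases b with
    | true =>
      rw [cond_true, EndAction.mem_eigenPiece_iff] at hy
      exact ⟨hy.2, fun _ => hy.1, fun h => by simp at h⟩
    | false =>
      rw [cond_false, EndAction.mem_eigenPiece_iff] at hy
      exact ⟨hy.2, fun h => by simp at h, fun _ => hy.1⟩
  have hp : B u w' ≠ 0 := by
    intro hp0
    apply hu0
    refine ψ.eq_zero_of_forall_form_eq_zero fun y => ?_
    have hy : y ∈ ⨆ i : (E →+* ℂ) × Bool, cond i.2 (A.eigenPiece i.1 1 0) (A.eigenPiece i.1 0 1) := htop ▸ Submodule.mem_top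
    induction hy using Submodule.iSup_induction' with
    | mem i y hy =>
      obtain ⟨hyχ, hy10, hy01⟩ := hmemχ i y hy
      rcases i with ⟨χ, b⟩
      by_cases hχ : χ = χ₁
      · subst hχ
        cases b with
        | true => exact hB1010 u hu_mem.1 y (hy10 rfl)
        | false =>
          obtain ⟨c, rfl⟩ := hw'_gen y (by simpa using hy)
          rw [map_smul, hp0, smul_zero]
      · exact horth₀ χ hχ u y hu_mem.2 hyχ
    | zero => rw [map_zero]
    | add x y _ _ hx hy => rw [map_add, hx, hy, add_zero]
  have hq : B w u' ≠ 0 := by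
    intro hq0
    apply hw0
    refine ψ.eq_zero_of_forall_form_eq_zero fun y => ?_
    have hy : y ∈ ⨆ i : (E →+* ℂ) × Bool, cond i.2 (A.eigenPiece i.1 1 0) (A.eigenPiece i.1 0 1) := htop ▸ Submodule.mem_top
    induction hy using Submodule.iSup_induction' with
    | mem i y hy =>
      obtain ⟨hyχ, hy10, hy01⟩ := hmemχ i y hy
      rcases i with ⟨χ, b⟩
      by_cases hχ : χ = χ₁
      · subst hχ
        cases b with
        | true =>
          obtain ⟨c, rfl⟩ := hu'_gen y (by simpa using hy)
          rw [map_smul, hq0, smul_zero]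
        | false => exact hB0101 w hw_mem.1 y (hy01 rfl)
      · exact horth₀ χ hχ w y hw_mem.2 hyχ
    | zero => rw [map_zero]
    | add x y _ _ hx hy => rw [map_add, hx, hy, add_zero]
  -- the `ψ`-projector onto `V_{χ₀}`: `R x = B(x,w')/p • u + B(x,u')/q • w`
  set R : Module.End ℂ (ℂ ⊗[ℚ] V) :=
    (B u w')⁻¹ • (LinearMap.flip B w').smulRight u + (B w u')⁻¹ • (LinearMap.flip B u').smulRight w with hR
  have hRapp : ∀ x, R x = ((B u w')⁻¹ * B x w') • u + ((B w u')⁻¹ * B x u') • w := fun x => by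
    simp only [hR, LinearMap.add_apply, LinearMap.smul_apply, LinearMap.smulRight_apply, LinearMap.flip_apply, smul_smul]
  -- `R` is the Lagrange projector, hence in the span of the `(ι e)_ℂ`
  obtain ⟨Z, hZmem, hZ⟩ := EndAction.exists_lagrange_mem_span A χ₀
  have hRZ : R = Z := by
    refine LinearMap.ext fun x => ?_
    have hx : x ∈ ⨆ i : (E →+* ℂ) × Bool, cond i.2 (A.eigenPiece i.1 1 0) (A.eigenPiece i.1 0 1) := htop ▸ Submodule.mem_top
    induction hx using Submodule.iSup_induction' with
    | mem i y hy =>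
      obtain ⟨hyχ, hy10, hy01⟩ := hmemχ i y hy
      rcases i with ⟨χ, b⟩
      rw [hZ χ y hyχ, hRapp]
      by_cases hχ : χ = χ₀
      · subst hχ
        rw [if_pos rfl, one_smul]
        cases b with
        | true =>
          obtain ⟨c, rfl⟩ := hu_gen y (by simpa using hy)
          rw [LinearMap.map_smul₂, LinearMap.map_smul₂, hBuu', smul_eq_mul, smul_eq_mul, mul_zero, mul_zero, zero_smul,
            add_zero, mul_comm c, inv_mul_cancel_left₀ hp]
        | false =>
          obtain ⟨c, rfl⟩ := hw_gen y (by simpa using hy)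
          rw [LinearMap.map_smul₂, LinearMap.map_smul₂, hBww', smul_eq_mul, smul_eq_mul, mul_zero, mul_zero, zero_smul,
            zero_add, mul_comm c, inv_mul_cancel_left₀ hq]
      · rw [if_neg hχ, zero_smul]
        have h1 : B y w' = 0 := by rw [hBswap, horth₁ χ hχ w' y hw'_mem.2 hyχ, neg_zero]
        have h2 : B y u' = 0 := by rw [hBswap, horth₁ χ hχ u' y hu'_mem.2 hyχ, neg_zero]
        rw [h1, h2, mul_zero, mul_zero, zero_smul, zero_smul, add_zero]
    | zero => rw [map_zero, map_zero]
    | add x y _ _ hx hy => rw [map_add, map_add, hx, hy]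
  -- `(Lie Hg)_ℂ` is trace-orthogonal to the span of the `(ι e)_ℂ`, hence to `R`
  have htrspan : ∀ Y ∈ H.hodgeLieC, ∀ Z' ∈ Submodule.span ℂ (Set.range fun e : E => (A.ι e).baseChange ℂ),
      LinearMap.trace ℂ _ (Z' * Y) = 0 := by
    intro Y hY Z' hZ'
    induction hZ' using Submodule.span_induction with
    | mem Z'' hZ'' =>
      obtain ⟨e, rfl⟩ := hZ''
      exact EndAction.trace_baseChange_mul_eq_zero_of_mem_hodgeLieC_of_balanced heff ψ A hbal hY e
    | zero => rw [zero_mul, map_zero]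
    | add Z₁ Z₂ _ _ h₁ h₂ => rw [add_mul, map_add, h₁, h₂, add_zero]
    | smul c Z₁ _ h₁ => rw [smul_mul_assoc, map_smul, h₁, smul_zero]
  have htrR : ∀ Y ∈ H.hodgeLieC, LinearMap.trace ℂ _ (R * Y) = 0 := fun Y hY => by
    rw [hRZ]; exact htrspan Y hY Z hZmem
  -- every `Y ∈ (Lie Hg)_ℂ` is traceless on the plane `V_{χ₁} = ℂu' ⊕ ℂw'`
  have hcoef : ∀ Y ∈ H.hodgeLieC, ∃ α β γ : ℂ, Y u' = α • u' + γ • w' ∧ Y w' = β • u' - α • w' := by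
    intro Y hY
    have hYι : ∀ e, Y * ιC e = ιC e * Y := fun e => commute_baseChange_of_mem_hodgeLieC H hY ⟨A.ι e, A.ι_mem_endAlg' e⟩
    have hYmem : ∀ y, (∀ e, ιC e y = χ₁ e • y) → ∀ e, ιC e (Y y) = χ₁ e • Y y := fun y hy e => by
      rw [← Module.End.mul_apply, ← hYι e, Module.End.mul_apply, hy e, map_smul]
    obtain ⟨α, γ, hαγ⟩ := hdec₁ (Y u') (hYmem u' hu'_mem.2)
    obtain ⟨β, δ, hβδ⟩ := hdec₁ (Y w') (hYmem w' hw'_mem.2)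
    -- `tr(R Y) = -(δ + α) = 0`
    have hRY : R * Y = -((B u w')⁻¹ • (LinearMap.flip B (Y w')).smulRight u) -
        (B w u')⁻¹ • (LinearMap.flip B (Y u')).smulRight w := by
      refine LinearMap.ext fun x => ?_
      have h1 : B (Y x) w' = -B x (Y w') := eq_neg_of_add_eq_zero_left (hskewC Y hY x w')
      have h2 : B (Y x) u' = -B x (Y u') := eq_neg_of_add_eq_zero_left (hskewC Y hY x u')
      simp only [hR, Module.End.mul_apply, LinearMap.add_apply, LinearMap.sub_apply, LinearMap.neg_apply,
        LinearMap.smul_apply, LinearMap.smulRight_apply, LinearMap.flip_apply]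
      rw [h1, h2]
      module
    have htr := htrR Y hY
    rw [hRY, map_sub, map_neg, map_smul, map_smul, LinearMap.trace_smulRight, LinearMap.trace_smulRight,
      LinearMap.flip_apply, LinearMap.flip_apply, hβδ, hαγ, map_add, map_smul, map_smul, map_add, map_smul, map_smul,
      hBuu', hBww'] at htr
    have hδα : δ + α = 0 := by
      have h := htr
      simp only [smul_eq_mul, mul_zero, add_zero, zero_add] at h
      -- `h : -(p⁻¹ * (δ * p)) - q⁻¹ * (α * q) = 0`
      have h' : -(δ + α) = 0 := by
        have e1 : (B u w')⁻¹ * (δ * B u w') = δ := by field_simp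
        have e2 : (B w u')⁻¹ * (α * B w u') = α := by field_simp
        rw [e1, e2] at h
        linear_combination h
      linear_combination -h'
    refine ⟨α, β, γ, hαγ, ?_⟩
    rw [hβδ, show δ = -α by linear_combination hδα, neg_smul, sub_eq_add_neg]
  -- the swap `S` commutes with `(Lie Hg)_ℂ`, hence lies in `End_Hdg ⊗ ℂ`
  set S : Module.End ℂ (ℂ ⊗[ℚ] V) := (LinearMap.flip B w').smulRight u' - (LinearMap.flip B u').smulRight w' with hS
  have hScomm : ∀ X ∈ H.hodgeLie, S * X.baseChange ℂ = X.baseChange ℂ * S := by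
    intro X hX
    have hY : X.baseChange ℂ ∈ H.hodgeLieC := H.baseChange_mem_hodgeLieC hX
    obtain ⟨α, β, γ, hαu, hβw⟩ := hcoef _ hY
    exact BalancedRankTwo.swap_comm B (hskewC _ hY) hαu hβw
  have hSspan := H.mem_span_endAlg_of_forall_commute hScomm
  -- conclusion
  by_contra hall
  push Not at hall
  have hcommE : ∀ T ∈ Submodule.span ℂ ((fun a : Module.End ℚ V => a.baseChange ℂ) '' (H.endAlg : Set _)),
      T * ιC e₀ = ιC e₀ * T := by
    intro T hT
    induction hT using Submodule.span_induction with
    | mem T hT =>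
      obtain ⟨a, ha, rfl⟩ := hT
      change a.baseChange ℂ * (A.ι e₀).baseChange ℂ = (A.ι e₀).baseChange ℂ * a.baseChange ℂ
      rw [← LinearMap.baseChange_mul, ← LinearMap.baseChange_mul, hall a ha]
    | zero => rw [zero_mul, mul_zero]
    | add T T' _ _ hT hT' => rw [add_mul, mul_add, hT, hT']
    | smul c T _ hT => rw [smul_mul_assoc, mul_smul_comm, hT]
  have hSu : S u = B u w' • u' := by
    simp only [hS, LinearMap.sub_apply, LinearMap.smulRight_apply, LinearMap.flip_apply]
    rw [hBuu', zero_smul, sub_zero]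
  have h := LinearMap.congr_fun (hcommE S hSspan) u
  rw [Module.End.mul_apply, Module.End.mul_apply, hu_mem.2 e₀, map_smul, hSu, map_smul, hu'_mem.2 e₀, smul_smul, smul_smul]
    at h
  -- `h : (p * conj χ₀ e₀) • u' = (χ₀ e₀ * p) • u'` up to the orientation of the equation
  have h' : (B u w' * χ₁ e₀ - χ₀ e₀ * B u w') • u' = 0 := by rw [sub_smul, h, sub_self]
  rcases smul_eq_zero.1 h' with h'' | h''
  · have h3 : B u w' * starRingEnd ℂ (χ₀ e₀) = B u w' * χ₀ e₀ := by
      rw [hχ₁, NumberField.ComplexEmbedding.conjugate_coe_eq] at h''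
      linear_combination h''
    exact he₀ (mul_left_cancel₀ hp h3)
  · exact hu'0 h''

end Main

end HodgeStructure

end Literature.AlgebraicGeometry.Motives

end
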